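import Literature.NumberTheory.LFunctions.ThetaChainFreeCheck
import HarnessLib

/-!
# Schoenfeld's `θ`-bound on `[599, 10⁸]` by kernel computation: data-free run, chunk 6 of 35

Topic: `Literature/NumberTheory/LFunctions`. Pure proof file (a kernel computation; nothing is
asserted, no definition). The theorems below evaluate `ThetaChain.runFree` — together `150000`
data-free steps of the certified `θ`-chain (`ThetaChain.stepFree`, `ThetaChainFreeCheck.lean`: the
next prime found and certified by two gcds with the primorials of the odd primes `≤ 2999` and in
`(2999, 10007]`, the enclosures of `log p` and `θ(p)`, and the two comparisons behind
`|θ(x) − x| ≤ √x log² x/(8π)`) — from the state at the prime `21260413` to the state at the prime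
`23799883`. Soundness: `ThetaChain.runFree_sound`; assembly of the 35 chunks: `ThetaUpTo1e8.lean`.
The expected states were obtained by evaluating a twin of the same function outside the kernel
(validated bit-for-bit on the tree's chunk `ThetaChainRun.xrun14`). Declarations of `5·10⁴` steps
(about `70 s` of kernel time each; the kernel's evaluation is linear within a declaration of this size),
`decide +kernel`, standard axioms only (`maxHeartbeats 0` lifts the deterministic time-out).

## References

* L. Schoenfeld, *Sharper bounds for the Chebyshev functions θ(x) and ψ(x). II*, Math. Comp. 30
  (1976), 337–360, Thm. 10 (6.3). [Schoenfeld1976]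
* J. B. Rosser, L. Schoenfeld, *Approximate formulas for some functions of prime numbers*,
  Illinois J. Math. 6 (1962), 64–94, Thms. 18–19 (`θ`-tables to `10⁸`). [RosserSchoenfeld1962]
-/

namespace Literature.NumberTheory.LFunctions.ThetaChainRun

open ThetaChain

set_option maxHeartbeats 0 in
/-- **Data-free certified `θ`-run, chunk 6a** (steps `750001`–`800000` after `8886113`: 50000 primes,
`21260413` to `22103297`). [cite: Schoenfeld1976, Thm. 10 (6.3)] -/
theorem frun6a :
    runFree 50000
      ⟨21260413, 20397428446450642465472225, 20397428446451118100685807, 25695154664245769872348650592457, 25695154664246409744575789925186⟩ =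
    some ⟨22103297, 20444431463022199361079704, 20444431463022674997285326, 26716207265178333449167394372528, 26716207265178997103180005587647⟩ := by
  decide +kernel

set_option maxHeartbeats 0 in
/-- **Data-free certified `θ`-run, chunk 6b** (steps `800001`–`850000` after `8886113`: 50000 primes,
`22103297` to `22950973`). [cite: Schoenfeld1976, Thm. 10 (6.3)] -/
theorem frun6b :
    runFree 50000
      ⟨22103297, 20444431463022199361079704, 20444431463022674997285326, 26716207265178333449167394372528, 26716207265178997103180005587647⟩ =
    some ⟨22950973, 20489927632339852450069050, 20489927632340328087259317, 27739575429620281028027336155937, 27739575429620968463874883463691⟩ := by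
  decide +kernel

set_option maxHeartbeats 0 in
/-- **Data-free certified `θ`-run, chunk 6c** (steps `850001`–`900000` after `8886113`: 50000 primes,
`22950973` to `23799883`). [cite: Schoenfeld1976, Thm. 10 (6.3)] -/
theorem frun6c :
    runFree 50000
      ⟨22950973, 20489927632339852450069050, 20489927632340328087259317, 27739575429620281028027336155937, 27739575429620968463874883463691⟩ =
    some ⟨23799883, 20533836220169118222726621, 20533836220169593860899923, 28765174891987238563176862234406, 28765174891987949780908496453365⟩ := by
  decide +kernel

end Literature.NumberTheory.LFunctions.ThetaChainRun
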